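import Literature.LinearAlgebra.QuadraticForm.FiniteFieldIsotropic
import Literature.Topology.FourManifolds.LatticeFormsLength
import Literature.Topology.FourManifolds.LatticeFormsEichlerCriterionDivisor
import Literature.Topology.FourManifolds.LatticeFormsSplitting
import Literature.Topology.FourManifolds.LatticeFormsRepresentsZeroProofs
import Mathlib.Data.ZMod.Basic
import Mathlib.LinearAlgebra.FiniteDimensional.Lemmas
import Mathlib.LinearAlgebra.Dimension.Constructions
import Mathlib.RingTheory.DedekindDomain.Ideal.Lemmas
import HarnessLib

/-!
# Nikulin's splitting theorem: an even indefinite lattice `L` with `rk L ≥ ℓ(A_L) + 3` splits a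
# hyperbolic plane, `L ≅ U ⊕ T` (Nikulin 1980, Cor. 1.13.5) — for lattices with an isotropic vector

Topic `Literature/Topology/FourManifolds` (the tree's integral-lattice corner: `LatticeForms*.lean`), lane
`lit-hodgefound` (Track 2 foundations; prover seat `lit-hodgefound-p18`, gen 34, row g34-#1). THEOREMS ONLY —
no `def`, no named fact, no instance, no notation.

## The source, as printed

V. V. Nikulin, *Integral symmetric bilinear forms and some of their applications*, Math. USSR Izv. **14**
(1980) 103–167, **Corollary 1.13.5** [Nikulin1980] (text not held; the statement is quoted from three held
restatements, verbatim): M. Mase, arXiv:1702.00107, Cor. 2.1 (p. 4) [Mase2017]: "If an even lattice `L` of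
signature `(t₊, t₋)` satisfies `t₊ ≥ 1`, `t₋ ≥ 1`, and `t₊ + t₋ ≥ 3 + length A_L`, then, there exists a
lattice `T` such that `L ≃ U ⊕ T`, where `U` is the hyperbolic lattice of rank `2`"; J. H. Bruinier,
arXiv:math/0307102, Lemma 6.4 (p. 30): "Suppose that `L` is an even indefinite lattice such that
`p-rank(L) ≤ dim(L) − 3` for all primes `p`, then `L ≅ M ⊕ II_{1,1}` for some lattice `M`. This is Corollary
1.13.5 in [Ni]"; arXiv:1902.11093 p. 28 (same, with `l(A_L^{(p)}) ≤ t⁺ + t⁻ − 3` for all `p`). Here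
`ℓ(A_L) = length A_L` is the minimal number of generators of the discriminant group `A_L = L^*/L`
(the tree's `LinearMap.BilinForm.length`, `LatticeFormsLength.lean`), and `U` is the tree's
`Literature.Topology.FourManifolds.hyperbolicForm` (Gram matrix `!![0, 1; 1, 0]`).

This is the hinge behind D. Huybrechts, *Lectures on K3 Surfaces*, Ch. 14 [Huybrechts2016K3]: Thm. 1.5 /
Rem. 1.6 (uniqueness in the genus), Thm. 2.4 (`O(Λ) ↠ O(A_Λ)`), Thm. 1.12 / Rem. 1.13, and the proof of
Cor. 3.8 ("there exists a hyperbolic plane `U ⊂ T(X)^⊥ = NS(X)`"), beyond the `U`-split case already in the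
tree (`LatticeFormsHyperbolicCancellation.lean` §4, `LatticeFormsDiscriminantFormLifting.lean`,
`LatticeFormsPrimitiveEmbeddingHyperbolicComplement.lean`): once `U` splits off, those files apply.

## What is here (all proved)

* **`exists_hyperbolic_pair_of_length_add_three_le`** — for a symmetric, even, nondegenerate form `B` on a
  finitely generated free `ℤ`-module `P` with `ℓ(A_B) + 3 ≤ rk P` **and a non-zero isotropic vector**, there
  are `x, y ∈ P` with `x.x = y.y = 0`, `x.y = 1` (a hyperbolic pair).
* **`exists_hyperbolic_pair_of_isIndefinite_of_length_add_three_le`** — the same for `B` indefinite of rank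
  `≥ 5` (the isotropic vector then comes from Meyer's theorem, proved in the tree:
  `Literature.NumberTheory.QuadraticForms.meyer_holds`; `exists_isotropic_of_five_le_finrank_of_nondegenerate`
  is the nondegenerate version of the tree's unimodular `exists_isotropic_of_five_le_finrank`).
* **`equivalent_hyperbolicForm_prod_of_length_add_three_le`** — Cor. 1.13.5 in the printed shape
  `L ≅ U ⊕ T` (`T = ⟨x, y⟩^⊥`, via the tree's `IsometryEquiv.splitHyperbolic`).
* `exists_hyperbolic_pair_pi` — the coordinate form on `ℤⁿ` with a Gram matrix `G`.
* `finrank_ker_map_le_length` — **`ℓ_p ≤ ℓ`**: the kernel of the Gram matrix modulo a prime `p` has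
  `𝔽_p`-dimension `≤ ℓ(A_L)` (a surjection `A_L ↠ 𝔽_pⁿ / Ḡ𝔽_pⁿ`).
* `exists_isotropic_not_mem_ker_polarBilin` — over a finite field, a quadratic form whose polar form has
  rank `≥ 3` has an isotropic vector outside the radical and outside any given hyperplane (Chevalley–Warning
  via the tree's `exists_isotropic_of_finite_of_three_le`, plus a spanning argument).

TODO(general form): Nikulin's Cor. 1.13.5 assumes only `t₊, t₋ ≥ 1` (indefinite); here the isotropic vector is
an explicit hypothesis, supplied by Meyer in rank `≥ 5`. The remaining printed case is rank `4` with
`ℓ(A_L) ≤ 1` (rank `3` with `ℓ = 0` does not occur for even lattices), where isotropy needs the quaternary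
Hasse–Minkowski analysis. The sharper `+ 2` statements of Nikulin's Thm. 1.13.3 / 1.14.2 (Huybrechts Thm. 1.5,
2.4) are NOT claimed: at `rk = ℓ + 2` a hyperbolic plane need not split (e.g. `[[2,1],[1,4]] ⊕ ⟨−6⟩`, rank 3,
`A ≅ ℤ/42`, indefinite, anisotropic at `3` on the unimodular part), and their proofs need the `p`-adic
genus theory (Eichler–Kneser), which the tree does not have.

## The proof (a direct local–global argument written for the tree; NOT Nikulin's route)

Nikulin derives 1.13.5 from his Thm. 1.13.3 (uniqueness in the genus) and Thm. 1.10.1 (existence with given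
discriminant form). Here instead, elementarily: a hyperbolic pair is the same as a primitive isotropic `e`
with divisor `div(e) = 1` (then `f' = f − ((f.f)/2) e` for any `f` with `e.f = 1`, Huybrechts Ch. 14 proof of
Cor. 1.14; the tree's `exists_hyperbolic_pair_of_isEven`). Start from any isotropic `v₀ ≠ 0`, make it
primitive, `v`, with divisor `d` (`(v.L) = dℤ`), and let `φ = (v.·)/d ∈ L^*`. Work in coordinates
`L = ℤⁿ`, Gram matrix `G = T + Tᵀ` (`T` upper triangular, `Q(x) = xᵀTx = (x.x)/2`). For every prime `p`
dividing `d · det G`: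
* if `p ∤ d` put `w_p = u₀` where `v.u₀ = d`;
* if `p^δ ∥ d`, `δ ≥ 1`: the form `G mod p` on `𝔽_pⁿ` has radical of dimension `≤ ℓ(A_L) ≤ n − 3`
  (`finrank_ker_map_le_length`), so (`exists_isotropic_not_mem_ker_polarBilin`, applied to `Q mod p` and
  `φ mod p ≠ 0`) there is `w` with `Q(w) ≡ 0`, `φ(w) ≢ 0 (mod p)` and `w.u ≢ 0 (mod p)` for some `u`;
  Hensel-lift (`Q(w + p^k t u) = Q(w) + p^k t (w.u) + p^{2k} t² Q(u)`) to `p^δ ∥ Q(w_p)` exactly.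
By the Chinese remainder theorem (Mathlib's `IsDedekindDomain.exists_forall_sub_mem_ideal`, coordinatewise)
choose `w ≡ w_p (mod p^{δ_p+1})` for all these `p`. Then `x = (v.w) w − Q(w) v` is isotropic, and for
`z = x / content(x)`: at `p ∤ d·det G`, `z ≢ 0` and `G` is invertible mod `p`; at `p ∣ det G`, `p ∤ d`,
`x.v = (v.w)²` is prime to `p`; at `p^δ ∥ d`, `x = p^δ x₁` with `φ(x₁) = (d/p^δ) φ(w)² ≢ 0` and
`x₁.u ≡ (d/p^δ) φ(w) (w.u) ≢ 0 (mod p)`, so the content of `x` is exactly `p^δ` at `p` and `z.u ≢ 0`.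
Hence no prime divides `div(z)`, i.e. `div(z) = 1`.

## References

* [Nikulin1980] V. V. Nikulin, Integral symmetric bilinear forms and some of their applications, Math. USSR
  Izv. 14 (1980) 103–167, Cor. 1.13.5 (also Thm. 1.13.3, 1.14.2, 1.14.4).
* [Mase2017] M. Mase, A mirror duality for families of K3 surfaces associated to bimodular singularities,
  Manuscripta Math. 149 (2016), arXiv:1702.00107, Cor. 2.1 (p. 4) — verbatim restatement of Cor. 1.13.5.
* [Huybrechts2016K3] D. Huybrechts, Lectures on K3 Surfaces, CUP 2016, Ch. 14: §0.1 (`ℓ`, `ℓ_p`), Thm. 1.5,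
  Rem. 1.6, Cor. 1.14 (proof), Rem. 1.13 (iii), Thm. 2.4, Cor. 3.8 (proof) (PDF pp. 331, 338, 340–341,
  344, 348–349).
* [IrelandRosen1982] K. Ireland, M. Rosen, A Classical Introduction to Modern Number Theory, Ch. 10 §2,
  Theorem 1 (Chevalley) and Corollary.
* [Serre1973] J.-P. Serre, A Course in Arithmetic, Ch. V §3.5 Lemma 5 (splitting off `U`), Ch. IV §3.2
  Cor. 2 (Meyer).
-/

open Module Matrix QuadraticMap

namespace Literature.Topology.FourManifolds

/-! ### §1 A finite-field lemma: isotropic vectors outside the radical and outside a hyperplane -/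

section FiniteField

variable {K : Type*} [Field K] [Fintype K] {V : Type*} [AddCommGroup V] [Module K V]
  [FiniteDimensional K V]

/-- **Isotropic vectors off the radical and off a hyperplane** (finite field `K`, any characteristic). If the
polar form of a quadratic form `Q` on `V` has radical `R` with `dim R + 3 ≤ dim V`, and `φ ≠ 0` is a linear
functional, there is `s` with `Q s = 0`, `s ∉ R`, `φ s ≠ 0`. Proof: on a complement `V₀ ⊉ R` of dimension
`≥ 3` Chevalley's theorem gives an isotropic `e ≠ 0` (Ireland–Rosen Ch. 10 §2: "a quadratic form in at least
three variables over a finite field has a non-trivial zero"; the tree's `exists_isotropic_of_finite_of_three_le`),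
`e ∉ R`; for every `y` with `b(e, y) ≠ 0` the vector `y − (Q(y)/b(e,y)) e` is isotropic and still pairs
non-trivially with `e`, so if `φ` vanished on all such vectors it would vanish identically.
[cite: IrelandRosen1982, Ch. 10 §2, Theorem 1 and Corollary] -/
theorem exists_isotropic_not_mem_ker_polarBilin (Q : QuadraticForm K V) (φ : Module.Dual K V)
    (hφ : φ ≠ 0)
    (hV : finrank K (LinearMap.ker (QuadraticMap.polarBilin Q)) + 3 ≤ finrank K V) :
    ∃ s : V, Q s = 0 ∧ s ∉ LinearMap.ker (QuadraticMap.polarBilin Q) ∧ φ s ≠ 0 := by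
  classical
  set R := LinearMap.ker (QuadraticMap.polarBilin Q) with hR
  have hmemR : ∀ x, x ∈ R ↔ ∀ y, polar Q x y = 0 := fun x => by
    rw [hR, LinearMap.mem_ker]
    constructor
    · intro h y
      rw [← QuadraticMap.polarBilin_apply_apply, h, LinearMap.zero_apply]
    · intro h
      ext y
      rw [QuadraticMap.polarBilin_apply_apply, h, LinearMap.zero_apply]
  obtain ⟨V₀, hV₀⟩ := R.exists_isCompl
  have hdim : 3 ≤ finrank K V₀ := by
    have := Submodule.finrank_add_eq_of_isCompl hV₀
    omega
  obtain ⟨e₀, he₀0, he₀⟩ :=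
    Literature.LinearAlgebra.QuadraticForm.exists_isotropic_of_finite_of_three_le
      (Q.comp V₀.subtype) hdim
  have he : Q (e₀ : V) = 0 := by simpa [QuadraticMap.comp_apply] using he₀
  have heR : (e₀ : V) ∉ R := by
    intro h
    have h2 : (e₀ : V) ∈ R ⊓ V₀ := ⟨h, e₀.2⟩
    rw [hV₀.inf_eq_bot, Submodule.mem_bot] at h2
    exact he₀0 (Subtype.ext h2)
  set e : V := (e₀ : V) with hedef
  -- some `y₀` pairs non-trivially with `e`
  have hey : ∃ y, polar Q e y ≠ 0 := by
    by_contra h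
    push Not at h
    exact heR ((hmemR e).2 h)
  obtain ⟨y₀, hy₀⟩ := hey
  -- the isotropic correction of a vector pairing non-trivially with `e`
  have key : ∀ y, polar Q e y ≠ 0 →
      ∃ t : K, Q (y + t • e) = 0 ∧ (y + t • e) ∉ R := by
    intro y hy
    refine ⟨-(Q y) / polar Q e y, ?_, ?_⟩
    · rw [QuadraticMap.map_add Q y, QuadraticMap.map_smul, he, smul_zero, add_zero,
        QuadraticMap.polar_smul_right, QuadraticMap.polar_comm Q y e, smul_eq_mul,
        div_mul_cancel₀ _ hy, add_neg_cancel]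
    · intro hmem
      have h1 := (hmemR _).1 hmem e
      rw [QuadraticMap.polar_add_left, QuadraticMap.polar_smul_left, QuadraticMap.polar_self,
        he, smul_zero, smul_zero, add_zero, QuadraticMap.polar_comm] at h1
      exact hy h1
  by_contra hcon
  push Not at hcon
  -- `hcon : ∀ s, Q s = 0 → s ∉ R → φ s = 0`
  have hφe : φ e = 0 := hcon e he heR
  have hφ1 : ∀ y, polar Q e y ≠ 0 → φ y = 0 := by
    intro y hy
    obtain ⟨t, ht, htR⟩ := key y hy
    have := hcon _ ht htR
    rwa [map_add, map_smul, hφe, smul_zero, add_zero] at this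
  have hφ2 : ∀ y, φ y = 0 := by
    intro y
    by_cases hy : polar Q e y = 0
    · have h1 : polar Q e (y + y₀) ≠ 0 := by
        rwa [QuadraticMap.polar_add_right, hy, zero_add]
      have h2 := hφ1 _ h1
      rw [map_add, hφ1 y₀ hy₀, add_zero] at h2
      exact h2
    · exact hφ1 y hy
  exact hφ (LinearMap.ext hφ2)

end FiniteField

namespace HyperbolicPlaneSplitting

variable {n : ℕ}

/-! ### §2 The half-Gram matrix `T` of an even symmetric Gram matrix `G = T + Tᵀ`, `Q(x) = xᵀ T x` -/

/-- An integral symmetric matrix with even diagonal is `T + Tᵀ` for an (upper triangular) integral `T`. [folklore] -/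
private theorem exists_add_transpose_eq {G : Matrix (Fin n) (Fin n) ℤ} (hG : G.IsSymm)
    (heven : ∀ i, 2 ∣ G i i) : ∃ T : Matrix (Fin n) (Fin n) ℤ, T + Tᵀ = G := by
  refine ⟨Matrix.of fun i j => if i < j then G i j else if i = j then G i i / 2 else 0, ?_⟩
  ext i j
  rw [Matrix.add_apply, transpose_apply, of_apply, of_apply]
  rcases lt_trichotomy i j with h | rfl | h
  · rw [if_pos h, if_neg (not_lt.mpr h.le), if_neg (ne_of_gt h)]
    simp
  · rw [if_neg (lt_irrefl i), if_pos rfl]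
    obtain ⟨k, hk⟩ := heven i
    omega
  · rw [if_neg (not_lt.mpr h.le), if_neg (ne_of_gt h), if_pos h, zero_add]
    exact (hG.apply j i).symm

variable {R : Type*} [CommRing R]

/-- `xᵀ Tᵀ y = yᵀ T x`. [folklore] -/
private theorem toBilin'_transpose_apply (T : Matrix (Fin n) (Fin n) R) (x y : Fin n → R) :
    Matrix.toBilin' Tᵀ x y = Matrix.toBilin' T y x := by
  rw [Matrix.toBilin'_apply', Matrix.toBilin'_apply', Matrix.dotProduct_mulVec, Matrix.vecMul_transpose,
    dotProduct_comm]

/-- `xᵀ (T + Tᵀ) y = xᵀ T y + yᵀ T x`. [folklore] -/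
private theorem toBilin'_add_transpose_apply (T : Matrix (Fin n) (Fin n) R) (x y : Fin n → R) :
    Matrix.toBilin' (T + Tᵀ) x y = Matrix.toBilin' T x y + Matrix.toBilin' T y x := by
  rw [map_add, LinearMap.add_apply, LinearMap.add_apply, toBilin'_transpose_apply]

/-- `Q(x + y) = Q(x) + G(x, y) + Q(y)` for `Q(x) = xᵀ T x`, `G = T + Tᵀ`. [folklore] -/
private theorem half_add {T G : Matrix (Fin n) (Fin n) R} (hT : T + Tᵀ = G) (x y : Fin n → R) :
    Matrix.toBilin' T (x + y) (x + y) =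
      Matrix.toBilin' T x x + Matrix.toBilin' G x y + Matrix.toBilin' T y y := by
  rw [← hT, toBilin'_add_transpose_apply]
  simp only [map_add, LinearMap.add_apply]
  abel

/-- `Q(a x) = a² Q(x)` for `Q(x) = xᵀ T x`. [folklore] -/
private theorem half_smul (T : Matrix (Fin n) (Fin n) R) (a : R) (x : Fin n → R) :
    Matrix.toBilin' T (a • x) (a • x) = a * a * Matrix.toBilin' T x x := by
  rw [LinearMap.map_smul₂, map_smul, smul_eq_mul, smul_eq_mul, mul_assoc]

/-- `2 Q(x) = xᵀ G x` for `Q(x) = xᵀ T x`, `G = T + Tᵀ`. [folklore] -/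
private theorem two_mul_half {T G : Matrix (Fin n) (Fin n) R} (hT : T + Tᵀ = G) (x : Fin n → R) :
    2 * Matrix.toBilin' T x x = Matrix.toBilin' G x x := by
  rw [← hT, toBilin'_add_transpose_apply, two_mul]

/-- `Q(x + a y) = Q(x) + a G(x, y) + a² Q(y)`. [folklore] -/
private theorem half_add_smul {T G : Matrix (Fin n) (Fin n) R} (hT : T + Tᵀ = G) (x y : Fin n → R) (a : R) :
    Matrix.toBilin' T (x + a • y) (x + a • y) =
      Matrix.toBilin' T x x + a * Matrix.toBilin' G x y + a * a * Matrix.toBilin' T y y := by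
  rw [half_add hT, half_smul, LinearMap.map_smul, smul_eq_mul]

/-! ### §3 Reduction modulo a prime: the radical of `Λ/pΛ` and `ℓ_p ≤ ℓ` -/

/-- Ring homomorphisms commute with `(x, y) ↦ xᵀ M y`. [folklore] -/
private theorem cast_toBilin' {S : Type*} [CommRing S] (f : R →+* S) (M : Matrix (Fin n) (Fin n) R)
    (x y : Fin n → R) :
    f (Matrix.toBilin' M x y) = Matrix.toBilin' (M.map f) (f ∘ x) (f ∘ y) := by
  have h : f ∘ (M *ᵥ y) = M.map f *ᵥ (f ∘ y) := funext fun i => RingHom.map_mulVec f M y i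
  rw [Matrix.toBilin'_apply', Matrix.toBilin'_apply', RingHom.map_dotProduct, h]

/-- `x G = G x` for symmetric `G`. [folklore] -/
private theorem vecMul_eq_mulVec_of_isSymm {G : Matrix (Fin n) (Fin n) R} (hG : G.IsSymm) (x : Fin n → R) :
    Matrix.vecMul x G = G *ᵥ x := by
  conv_lhs => rw [← hG.eq]
  rw [Matrix.vecMul_transpose]

/-- The polar form of `x ↦ xᵀ T x` is `(x, y) ↦ xᵀ (T + Tᵀ) y`. [folklore] -/
private theorem polarBilin_half_apply {K : Type*} [CommRing K] {T G : Matrix (Fin n) (Fin n) K} (hT : T + Tᵀ = G)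
    (x y : Fin n → K) :
    QuadraticMap.polarBilin (Matrix.toBilin' T).toQuadraticMap x y = Matrix.toBilin' G x y := by
  rw [QuadraticMap.polarBilin_apply_apply, LinearMap.BilinMap.polar_toQuadraticMap,
    ← toBilin'_add_transpose_apply, hT]

/-- Membership in the kernel of the polar form of `x ↦ xᵀ T x` is `G x = 0`, `G = T + Tᵀ`. [folklore] -/
private theorem mem_ker_polarBilin_iff {K : Type*} [CommRing K] {T G : Matrix (Fin n) (Fin n) K} (hT : T + Tᵀ = G)
    (hG : G.IsSymm) (x : Fin n → K) :
    x ∈ LinearMap.ker (QuadraticMap.polarBilin (Matrix.toBilin' T).toQuadraticMap) ↔ G *ᵥ x = 0 := by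
  rw [LinearMap.mem_ker]
  constructor
  · intro h
    ext i
    have := LinearMap.congr_fun h (Pi.single i 1)
    rw [polarBilin_half_apply hT, LinearMap.zero_apply, Matrix.toBilin'_apply', Matrix.dotProduct_mulVec,
      dotProduct_single, mul_one, vecMul_eq_mulVec_of_isSymm hG] at this
    exact this
  · intro h
    refine LinearMap.ext fun y => ?_
    rw [polarBilin_half_apply hT, LinearMap.zero_apply, Matrix.toBilin'_apply', Matrix.dotProduct_mulVec,
      vecMul_eq_mulVec_of_isSymm hG, h, zero_dotProduct]

/-- The radical of the polar form of `x ↦ xᵀ T x` is `ker G`, `G = T + Tᵀ` symmetric. [folklore] -/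
private theorem ker_polarBilin_eq {K : Type*} [CommRing K] {T G : Matrix (Fin n) (Fin n) K} (hT : T + Tᵀ = G)
    (hG : G.IsSymm) :
    LinearMap.ker (QuadraticMap.polarBilin (Matrix.toBilin' T).toQuadraticMap) = LinearMap.ker G.mulVecLin := by
  ext x
  rw [mem_ker_polarBilin_iff hT hG, LinearMap.mem_ker, Matrix.mulVecLin_apply]






/-- **`ℓ_p ≤ ℓ(A_Λ)`**: for an integral symmetric Gram matrix `G` and a prime `p`, the kernel of
`G mod p` on `𝔽_pⁿ` (the radical of `Λ/pΛ`) has `𝔽_p`-dimension at most the length `ℓ(A_Λ)` of the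
discriminant group — the reduction `Λ^* → 𝔽_pⁿ` induces a surjection `A_Λ = Λ^*/Λ ↠ 𝔽_pⁿ/Ḡ𝔽_pⁿ`, whose
target has dimension `n − rk Ḡ = dim ker Ḡ` and is spanned by the images of `ℓ(A_Λ)` generators ("`A_Λ ⊗ ℤ_p
≃ ⊕ (ℤ/p^{kᵢ}ℤ)` … `(ℤ/pℤ)^{ℓ_p}`", `ℓ_p ≤ ℓ`).
[cite: Huybrechts2016K3, Ch. 14 §0.1 ("`A_Λ ⊗ ℤ_p ≃ ⊕ (ℤ/p^{k_i}ℤ)`", "`(ℤ/pℤ)^{ℓ_p}`")] -/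
theorem finrank_ker_map_le_length (p : ℕ) [Fact p.Prime] {G : Matrix (Fin n) (Fin n) ℤ} (hG : G.IsSymm) :
    finrank (ZMod p) (LinearMap.ker (G.map (Int.castRingHom (ZMod p))).mulVecLin) ≤
      (Matrix.toBilin' G).length := by
  classical
  set Gb : Matrix (Fin n) (Fin n) (ZMod p) := G.map (Int.castRingHom (ZMod p)) with hGb
  set S : Submodule (ZMod p) (Fin n → (ZMod p)) := LinearMap.range Gb.mulVecLin with hS
  -- the reduction map `Λ^* → 𝔽_pⁿ / S`
  let red : (Fin n → ℤ) →+ (Fin n → (ZMod p)) :=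
    { toFun := fun x i => (x i : (ZMod p))
      map_zero' := by ext i; simp
      map_add' := fun x y => by ext i; simp }
  let ev : Module.Dual ℤ (Fin n → ℤ) →+ (Fin n → ℤ) :=
    { toFun := fun f i => f (Pi.single i 1)
      map_zero' := by ext i; simp
      map_add' := fun f g => by ext i; simp }
  let π : Module.Dual ℤ (Fin n → ℤ) →+ (Fin n → (ZMod p)) ⧸ S := S.mkQ.toAddMonoidHom.comp (red.comp ev)
  have hπ : ∀ f, π f = S.mkQ (fun i => (f (Pi.single i 1) : (ZMod p))) := fun f => rfl
  -- `π` kills `range B`, `B = toBilin' G`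
  have hker : LinearMap.range (Matrix.toBilin' G) ≤ LinearMap.ker π.toIntLinearMap := by
    rintro f ⟨x, rfl⟩
    rw [LinearMap.mem_ker, AddMonoidHom.coe_toIntLinearMap, hπ, Submodule.mkQ_apply,
      Submodule.Quotient.mk_eq_zero, hS, LinearMap.mem_range]
    refine ⟨fun i => (x i : (ZMod p)), ?_⟩
    ext i
    rw [Matrix.mulVecLin_apply, Matrix.toBilin'_apply', Matrix.dotProduct_mulVec, dotProduct_single, mul_one,
      vecMul_eq_mulVec_of_isSymm hG]
    have h := RingHom.map_mulVec (Int.castRingHom (ZMod p)) G x i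
    rw [eq_intCast] at h
    rw [h]
    rfl
  let πb : (Matrix.toBilin' G).discriminantGroup →ₗ[ℤ] (Fin n → (ZMod p)) ⧸ S :=
    (LinearMap.range (Matrix.toBilin' G)).liftQ π.toIntLinearMap hker
  have hπb : ∀ f, πb (Submodule.Quotient.mk f) = π f := fun f => rfl
  -- `π` is onto
  have hsurj : Function.Surjective πb := by
    intro t
    obtain ⟨w, rfl⟩ := Submodule.mkQ_surjective S t
    refine ⟨Submodule.Quotient.mk (Matrix.toBilin' (1 : Matrix (Fin n) (Fin n) ℤ) fun i => (w i).cast), ?_⟩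
    rw [hπb, hπ]
    congr 1
    ext i
    rw [Matrix.toBilin'_apply', Matrix.one_mulVec, dotProduct_single, mul_one, ZMod.intCast_zmod_cast]
  -- a generating set of `A_Λ` of size `ℓ` maps to a generating set of the quotient
  obtain ⟨s, hs, hs'⟩ := (Matrix.toBilin' G).exists_finset_card_eq_length
    ((Matrix.toBilin' G).fg_discriminantGroup)
  have hcl : AddSubgroup.closure ((s.image πb : Finset _) : Set ((Fin n → (ZMod p)) ⧸ S)) = ⊤ := by
    have h := AddMonoidHom.map_closure πb.toAddMonoidHom (s : Set (Matrix.toBilin' G).discriminantGroup)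
    rw [hs', AddSubgroup.map_top_of_surjective πb.toAddMonoidHom fun t => hsurj t] at h
    rw [Finset.coe_image]
    exact h.symm
  have hspan : Submodule.span (ZMod p) ((s.image πb : Finset _) : Set ((Fin n → (ZMod p)) ⧸ S)) = ⊤ := by
    rw [eq_top_iff]
    intro t _
    have ht : t ∈ AddSubgroup.closure ((s.image πb : Finset _) : Set ((Fin n → (ZMod p)) ⧸ S)) := by
      rw [hcl]; trivial
    exact (AddSubgroup.closure_le (K := (Submodule.span (ZMod p) _).toAddSubgroup)).mpr Submodule.subset_span ht
  have hquot : finrank (ZMod p) ((Fin n → (ZMod p)) ⧸ S) ≤ (Matrix.toBilin' G).length := by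
    calc finrank (ZMod p) ((Fin n → (ZMod p)) ⧸ S)
        = finrank (ZMod p) (Submodule.span (ZMod p) ((s.image πb : Finset _) : Set ((Fin n → (ZMod p)) ⧸ S))) := by
          rw [hspan, finrank_top]
      _ ≤ (s.image πb).card := finrank_span_finset_le_card _
      _ ≤ s.card := Finset.card_image_le
      _ = _ := hs
  have h1 := LinearMap.finrank_range_add_finrank_ker Gb.mulVecLin
  rw [← hS] at h1
  have h2 := Submodule.finrank_quotient_add_finrank S
  omega



/-! ### §4 Local vectors at a prime, Hensel lifting, and the Chinese remainder theorem in `ℤⁿ` -/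

/-- Reduction mod `p` of `T + Tᵀ = G`. [folklore] -/
private theorem map_castRingHom_add_transpose (p : ℕ) {T G : Matrix (Fin n) (Fin n) ℤ} (hT : T + Tᵀ = G) :
    T.map (Int.castRingHom (ZMod p)) + (T.map (Int.castRingHom (ZMod p)))ᵀ =
      G.map (Int.castRingHom (ZMod p)) := by
  ext i j
  rw [← hT, Matrix.add_apply, Matrix.map_apply, Matrix.transpose_apply, Matrix.map_apply, Matrix.map_apply,
    Matrix.add_apply, Matrix.transpose_apply, map_add]

/-- Reduction mod `p` of `xᵀ M y`. [folklore] -/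
private theorem intCast_toBilin' (p : ℕ) (M : Matrix (Fin n) (Fin n) ℤ) (x y : Fin n → ℤ) :
    ((Matrix.toBilin' M x y : ℤ) : ZMod p) =
      Matrix.toBilin' (M.map (Int.castRingHom (ZMod p))) (fun i => (x i : ZMod p)) (fun i => (y i : ZMod p)) :=
  cast_toBilin' (Int.castRingHom (ZMod p)) M x y

/-- A `ℤ`-linear functional on `ℤⁿ` is the dot product with its values on the standard basis. [folklore] -/
private theorem dual_apply_eq_dotProduct (f : Module.Dual ℤ (Fin n → ℤ)) (y : Fin n → ℤ) :
    f y = (fun i => f (Pi.single i 1)) ⬝ᵥ y := by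
  classical
  rw [LinearMap.pi_apply_eq_sum_univ f y, dotProduct]
  refine Finset.sum_congr rfl fun i _ => ?_
  rw [smul_eq_mul, mul_comm]
  congr 2
  ext j
  rw [Pi.single_apply]
  exact if_congr eq_comm rfl rfl

/-- **Local step at a prime `p`**: if the Gram matrix mod `p` has rank `≥ 3` and `f` is a functional not
vanishing mod `p`, there is `w` with `Q(w) ≡ 0`, `f(w) ≢ 0 (mod p)` and `w ∉ rad(Λ/pΛ)`. [folklore] -/
private theorem exists_local_vector (p : ℕ) [Fact p.Prime] {G T : Matrix (Fin n) (Fin n) ℤ} (hG : G.IsSymm)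
    (hT : T + Tᵀ = G)
    (hrank : finrank (ZMod p) (LinearMap.ker (G.map (Int.castRingHom (ZMod p))).mulVecLin) + 3 ≤ n)
    (f : Module.Dual ℤ (Fin n → ℤ)) {u₀ : Fin n → ℤ} (hu₀ : ¬ (p : ℤ) ∣ f u₀) :
    ∃ w : Fin n → ℤ, (p : ℤ) ∣ Matrix.toBilin' T w w ∧ ¬ (p : ℤ) ∣ f w ∧
      ∃ u : Fin n → ℤ, ¬ (p : ℤ) ∣ Matrix.toBilin' G w u := by
  classical
  have hTb := map_castRingHom_add_transpose p hT
  have hGb : (G.map (Int.castRingHom (ZMod p))).IsSymm := hG.map _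
  -- the functional mod `p`
  have hf := dual_apply_eq_dotProduct f
  let φ : Module.Dual (ZMod p) (Fin n → ZMod p) :=
    Matrix.toBilin' (1 : Matrix (Fin n) (Fin n) (ZMod p)) fun i => (f (Pi.single i 1) : ZMod p)
  have hφ : ∀ y : Fin n → ℤ, φ (fun i => (y i : ZMod p)) = ((f y : ℤ) : ZMod p) := by
    intro y
    change Matrix.toBilin' (1 : Matrix (Fin n) (Fin n) (ZMod p)) _ _ = _
    rw [Matrix.toBilin'_apply', Matrix.one_mulVec, hf y]
    exact (RingHom.map_dotProduct (Int.castRingHom (ZMod p)) _ y).symm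
  have hφ0 : φ ≠ 0 := by
    intro h
    apply hu₀
    rw [← ZMod.intCast_zmod_eq_zero_iff_dvd, ← hφ, h, LinearMap.zero_apply]
  let Qb : QuadraticForm (ZMod p) (Fin n → ZMod p) :=
    (Matrix.toBilin' (T.map (Int.castRingHom (ZMod p)))).toQuadraticMap
  have hker : finrank (ZMod p) (LinearMap.ker (QuadraticMap.polarBilin Qb)) + 3 ≤
      finrank (ZMod p) (Fin n → ZMod p) := by
    rw [ker_polarBilin_eq hTb hGb, Module.finrank_fin_fun]
    exact hrank
  obtain ⟨s, hs0, hsR, hsφ⟩ := exists_isotropic_not_mem_ker_polarBilin Qb φ hφ0 hker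
  have hw : (fun i => (((s i).cast : ℤ) : ZMod p)) = s := funext fun i => ZMod.intCast_zmod_cast (s i)
  refine ⟨fun i => (s i).cast, ?_, ?_, ?_⟩
  · rw [← ZMod.intCast_zmod_eq_zero_iff_dvd, intCast_toBilin', hw]
    exact hs0
  · rw [← ZMod.intCast_zmod_eq_zero_iff_dvd, ← hφ, hw]
    exact hsφ
  · rw [mem_ker_polarBilin_iff hTb hGb] at hsR
    obtain ⟨i, hi⟩ : ∃ i, (G.map (Int.castRingHom (ZMod p)) *ᵥ s) i ≠ 0 := by
      by_contra h
      push Not at h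
      exact hsR (funext h)
    refine ⟨Pi.single i 1, ?_⟩
    rw [← ZMod.intCast_zmod_eq_zero_iff_dvd, intCast_toBilin', hw, Matrix.toBilin'_apply',
      Matrix.dotProduct_mulVec, vecMul_eq_mulVec_of_isSymm hGb]
    have h1 : (fun j => (((Pi.single i (1 : ℤ) : Fin n → ℤ) j : ℤ) : ZMod p)) = Pi.single i 1 := by
      ext j
      rw [Pi.single_apply, Pi.single_apply]
      split_ifs <;> simp
    rw [h1, dotProduct_single, mul_one]
    exact hi

/-- **Hensel step**: `p ∤ G(w,u)`, `p^k ∣ Q(w)`, `k ≥ 1` ⟹ `p^{k+1} ∣ Q(w + p^k t u)` for some `t`.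
[folklore] -/
private theorem hensel_step {p : ℕ} [Fact p.Prime] {T G : Matrix (Fin n) (Fin n) ℤ} (hT : T + Tᵀ = G)
    {w u : Fin n → ℤ} (hu : ¬ (p : ℤ) ∣ Matrix.toBilin' G w u) {k : ℕ} (hk : 1 ≤ k)
    (hw : (p : ℤ) ^ k ∣ Matrix.toBilin' T w w) :
    ∃ t : ℤ, (p : ℤ) ^ (k + 1) ∣ Matrix.toBilin' T (w + ((p : ℤ) ^ k * t) • u) (w + ((p : ℤ) ^ k * t) • u) := by
  obtain ⟨a, ha⟩ := hw
  set β := Matrix.toBilin' G w u with hβ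
  have hβ0 : (β : ZMod p) ≠ 0 := by rwa [Ne, ZMod.intCast_zmod_eq_zero_iff_dvd]
  set t : ℤ := ((-(a : ZMod p)) * (β : ZMod p)⁻¹).cast with ht
  have hpt : (p : ℤ) ∣ a + t * β := by
    rw [← ZMod.intCast_zmod_eq_zero_iff_dvd, Int.cast_add, Int.cast_mul, ht, ZMod.intCast_zmod_cast,
      mul_assoc, inv_mul_cancel₀ hβ0, mul_one, add_neg_cancel]
  obtain ⟨m, hm⟩ := hpt
  refine ⟨t, ?_⟩
  rw [half_add_smul hT, ha, ← hβ]
  have h1 : (p : ℤ) ^ k * a + (p : ℤ) ^ k * t * β = (p : ℤ) ^ (k + 1) * m := by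
    rw [pow_succ, mul_assoc _ (p : ℤ) m, ← hm]
    ring
  have h2 : (p : ℤ) ^ (k + 1) ∣ (p : ℤ) ^ k * t * ((p : ℤ) ^ k * t) * Matrix.toBilin' T u u := by
    have h3 : (p : ℤ) ^ (k + 1) ∣ (p : ℤ) ^ k * (p : ℤ) ^ k := by
      rw [← pow_add]
      exact pow_dvd_pow _ (by omega)
    exact Dvd.dvd.mul_right (by
      have : (p : ℤ) ^ k * t * ((p : ℤ) ^ k * t) = (p : ℤ) ^ k * (p : ℤ) ^ k * (t * t) := by ring
      rw [this]
      exact Dvd.dvd.mul_right h3 _) _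
  calc (p : ℤ) ^ (k + 1) ∣ (p : ℤ) ^ (k + 1) * m + (p : ℤ) ^ k * t * ((p : ℤ) ^ k * t) * Matrix.toBilin' T u u :=
        Dvd.dvd.add (Dvd.intro _ rfl) h2
    _ = _ := by rw [← h1]

/-- `G(w + p y, u) ≡ G(w, u) (mod p)`. [folklore] -/
private theorem not_dvd_toBilin'_add_smul {p : ℤ} {G : Matrix (Fin n) (Fin n) ℤ} {w u : Fin n → ℤ}
    (hu : ¬ p ∣ Matrix.toBilin' G w u) (y : Fin n → ℤ) : ¬ p ∣ Matrix.toBilin' G (w + p • y) u := by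
  rw [map_add, LinearMap.add_apply, LinearMap.map_smul, LinearMap.smul_apply, smul_eq_mul]
  exact fun h => hu ((dvd_add_left (Dvd.intro _ rfl)).mp h)

/-- **Hensel lifting**: from `p ∣ Q(w)` and `p ∤ G(w,u)` to `p^m ∣ Q(w')` with `w' ≡ w (mod p)`. [folklore] -/
private theorem hensel_lift {p : ℕ} [Fact p.Prime] {T G : Matrix (Fin n) (Fin n) ℤ} (hT : T + Tᵀ = G)
    {w u : Fin n → ℤ} (hu : ¬ (p : ℤ) ∣ Matrix.toBilin' G w u) (hw : (p : ℤ) ∣ Matrix.toBilin' T w w)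
    {m : ℕ} (hm : 1 ≤ m) :
    ∃ w' : Fin n → ℤ, (∃ y, w' = w + (p : ℤ) • y) ∧ (p : ℤ) ^ m ∣ Matrix.toBilin' T w' w' := by
  induction m, hm using Nat.le_induction with
  | base => exact ⟨w, ⟨0, by simp⟩, by rwa [pow_one]⟩
  | succ k hk ih =>
    obtain ⟨w', ⟨y, rfl⟩, hw'⟩ := ih
    obtain ⟨t, ht⟩ := hensel_step hT (not_dvd_toBilin'_add_smul hu y) hk hw'
    refine ⟨_, ⟨y + ((p : ℤ) ^ (k - 1) * t) • u, ?_⟩, ht⟩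
    rw [smul_add, add_assoc, smul_smul, ← mul_assoc, ← pow_succ', Nat.sub_add_cancel hk]

/-- **Exact order**: moreover `w'` can be taken with `p^m ∥ Q(w')` exactly, `m ≥ 1`. [folklore] -/
private theorem hensel_exact {p : ℕ} [Fact p.Prime] {T G : Matrix (Fin n) (Fin n) ℤ} (hT : T + Tᵀ = G)
    {w u : Fin n → ℤ} (hu : ¬ (p : ℤ) ∣ Matrix.toBilin' G w u) (hw : (p : ℤ) ∣ Matrix.toBilin' T w w)
    {m : ℕ} (hm : 1 ≤ m) :
    ∃ w' : Fin n → ℤ, (∃ y, w' = w + (p : ℤ) • y) ∧ (p : ℤ) ^ m ∣ Matrix.toBilin' T w' w' ∧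
      ¬ (p : ℤ) ^ (m + 1) ∣ Matrix.toBilin' T w' w' := by
  obtain ⟨w', ⟨y, rfl⟩, hw'⟩ := hensel_lift hT hu hw hm
  by_cases h : (p : ℤ) ^ (m + 1) ∣ Matrix.toBilin' T (w + (p : ℤ) • y) (w + (p : ℤ) • y)
  · have hu' := not_dvd_toBilin'_add_smul hu y
    refine ⟨w + (p : ℤ) • y + ((p : ℤ) ^ m) • u, ⟨y + ((p : ℤ) ^ (m - 1)) • u, ?_⟩, ?_, ?_⟩
    · rw [smul_add, add_assoc, smul_smul, ← pow_succ', Nat.sub_add_cancel hm]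
    · rw [half_add_smul hT]
      refine Dvd.dvd.add (Dvd.dvd.add hw' (Dvd.intro _ rfl)) ?_
      exact Dvd.dvd.mul_right (Dvd.dvd.mul_right (dvd_refl _) _) _
    · rw [half_add_smul hT]
      intro h2
      have h3 : (p : ℤ) ^ (m + 1) ∣ (p : ℤ) ^ m * (p : ℤ) ^ m * Matrix.toBilin' T u u := by
        refine Dvd.dvd.mul_right ?_ _
        rw [← pow_add]
        exact pow_dvd_pow _ (by omega)
      have h4 : (p : ℤ) ^ (m + 1) ∣ (p : ℤ) ^ m * Matrix.toBilin' G (w + (p : ℤ) • y) u := by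
        have := (dvd_add_right h).mp ((dvd_add_left h3).mp h2)
        exact this
      rw [pow_succ, mul_dvd_mul_iff_left (pow_ne_zero _ (Nat.cast_ne_zero.mpr (Fact.out : p.Prime).ne_zero))]
        at h4
      exact hu' h4
  · exact ⟨w + (p : ℤ) • y, ⟨y, rfl⟩, hw', h⟩

/-- **CRT in `ℤⁿ`**: simultaneous congruences `w ≡ a_p (mod p^{e_p} ℤⁿ)` for finitely many primes.
[folklore] -/
private theorem exists_forall_coord_congr (S : Finset ℕ) (hS : ∀ p ∈ S, p.Prime) (e : ℕ → ℕ)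
    (a : ℕ → (Fin n → ℤ)) :
    ∃ w : Fin n → ℤ, ∀ p ∈ S, ∃ y : Fin n → ℤ, w = a p + ((p : ℤ) ^ e p) • y := by
  classical
  have hprime : ∀ p ∈ S, Prime (Ideal.span {(p : ℤ)}) := fun p hp => by
    refine Ideal.prime_of_isPrime ?_ ?_
    · rw [Ne, Ideal.span_singleton_eq_bot]
      exact_mod_cast (hS p hp).ne_zero
    · exact (Ideal.span_singleton_prime (by exact_mod_cast (hS p hp).ne_zero)).mpr
        (Nat.prime_iff_prime_int.mp (hS p hp))
  have hcop : ∀ᵉ (p ∈ S) (q ∈ S), p ≠ q → Ideal.span {(p : ℤ)} ≠ Ideal.span {(q : ℤ)} := by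
    intro p hp q hq hpq h
    rw [Ideal.span_singleton_eq_span_singleton, ← Int.natAbs_eq_iff_associated, Int.natAbs_natCast,
      Int.natAbs_natCast] at h
    exact hpq h
  have hcoord : ∀ i : Fin n, ∃ z : ℤ, ∀ p ∈ S, (p : ℤ) ^ e p ∣ z - a p i := by
    intro i
    obtain ⟨z, hz⟩ := IsDedekindDomain.exists_forall_sub_mem_ideal (fun p : ℕ => Ideal.span {(p : ℤ)}) e
      hprime hcop (fun p => a p i)
    refine ⟨z, fun p hp => ?_⟩
    have := hz p hp
    rwa [Ideal.span_singleton_pow, Ideal.mem_span_singleton] at this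
  choose z hz using hcoord
  refine ⟨z, fun p hp => ⟨fun i => (z i - a p i) / (p : ℤ) ^ e p, ?_⟩⟩
  ext i
  rw [Pi.add_apply, Pi.smul_apply, smul_eq_mul, Int.mul_ediv_cancel' (hz i p hp), add_sub_cancel]


/-! ### §5 The global step: from the local data to a vector of divisor one -/

/-- A vector of `ℤⁿ` with all coordinates divisible by `m` is `m • y`. [folklore] -/
private theorem exists_eq_smul_of_forall_dvd {m : ℤ} {x : Fin n → ℤ} (h : ∀ i, m ∣ x i) :
    ∃ y : Fin n → ℤ, x = m • y := by
  choose y hy using h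
  exact ⟨y, funext fun i => by rw [Pi.smul_apply, smul_eq_mul, hy i]⟩

/-- A vector with coprime coordinates is non-zero modulo every prime. [folklore] -/
private theorem not_forall_dvd_of_gcd_eq_one {z : Fin n → ℤ} (hz : Finset.univ.gcd z = 1) {p : ℕ}
    (hp : p.Prime) : ¬ ∀ i, (p : ℤ) ∣ z i := by
  intro h
  have h1 : (p : ℤ) ∣ Finset.univ.gcd z := Finset.dvd_gcd fun i _ => h i
  rw [hz, Int.natCast_dvd, Int.natAbs_one, Nat.dvd_one] at h1
  exact hp.one_lt.ne' h1

/-- `xᵀ G y = yᵀ G x` for symmetric `G`. [folklore] -/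
private theorem toBilin'_comm {G : Matrix (Fin n) (Fin n) R} (hG : G.IsSymm) (x y : Fin n → R) :
    Matrix.toBilin' G x y = Matrix.toBilin' G y x :=
  (Matrix.isSymm_toBilin'_iff_isSymm.mpr hG).eq x y

/-- `G(z, e_i) = (G z)_i`. [folklore] -/
private theorem toBilin'_single_right {G : Matrix (Fin n) (Fin n) R} (hG : G.IsSymm) (z : Fin n → R) (i : Fin n) :
    Matrix.toBilin' G z (Pi.single i 1) = (G *ᵥ z) i := by
  rw [Matrix.toBilin'_apply', Matrix.dotProduct_mulVec, dotProduct_single, mul_one,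
    vecMul_eq_mulVec_of_isSymm hG]

/-- **Primes not dividing the discriminant**: a vector which is non-zero mod `p` pairs to a unit mod `p`
with some vector, since the Gram matrix is invertible mod `p`. [folklore] -/
private theorem exists_not_dvd_of_not_dvd_det {p : ℕ} [Fact p.Prime] {G : Matrix (Fin n) (Fin n) ℤ}
    (hG : G.IsSymm) (hdet : ¬ (p : ℤ) ∣ G.det) {z : Fin n → ℤ} (hz : ¬ ∀ i, (p : ℤ) ∣ z i) :
    ∃ t : Fin n → ℤ, ¬ (p : ℤ) ∣ Matrix.toBilin' G z t := by
  classical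
  by_contra h
  push Not at h
  apply hz
  have hdet' : (G.map (Int.castRingHom (ZMod p))).det ≠ 0 := by
    rw [← RingHom.mapMatrix_apply, ← RingHom.map_det, Ne, eq_intCast, ZMod.intCast_zmod_eq_zero_iff_dvd]
    exact hdet
  have hzero : G.map (Int.castRingHom (ZMod p)) *ᵥ (fun i => (z i : ZMod p)) = 0 := by
    ext i
    have h1 := h (Pi.single i 1)
    rw [toBilin'_single_right hG, ← ZMod.intCast_zmod_eq_zero_iff_dvd] at h1
    rw [Pi.zero_apply, ← h1]
    exact (RingHom.map_mulVec (Int.castRingHom (ZMod p)) G z i).symm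
  have h2 := Matrix.eq_zero_of_mulVec_eq_zero hdet' hzero
  intro i
  rw [← ZMod.intCast_zmod_eq_zero_iff_dvd]
  exact congr_fun h2 i

/-- **Progress primes** (`p ∣ d`): with the local conditions at `p`, the normalised vector `z = x /
content(x)`, `x = (v.w) w − Q(w) v`, pairs to a unit mod `p` with `u`. [folklore] -/
private theorem not_dvd_of_progress {p : ℕ} (hp : p.Prime) {T G : Matrix (Fin n) (Fin n) ℤ}
    {v w u x z : Fin n → ℤ} {d c : ℤ} {δ : ℕ} (hδ : 1 ≤ δ)
    (φ : Module.Dual ℤ (Fin n → ℤ)) (hφ : ∀ t, d * φ t = Matrix.toBilin' G v t) (hφv : φ v = 0)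
    (hpd : (p : ℤ) ^ δ ∣ d) (hpd' : ¬ (p : ℤ) ^ (δ + 1) ∣ d)
    (hφw : ¬ (p : ℤ) ∣ φ w) (hu : ¬ (p : ℤ) ∣ Matrix.toBilin' G w u)
    (hq : (p : ℤ) ^ δ ∣ Matrix.toBilin' T w w) (hq' : ¬ (p : ℤ) ^ (δ + 1) ∣ Matrix.toBilin' T w w)
    (hx : x = Matrix.toBilin' G v w • w - Matrix.toBilin' T w w • v)
    (hcz : x = c • z) (hc : Finset.univ.gcd x = c) :
    ¬ (p : ℤ) ∣ Matrix.toBilin' G z u := by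
  have hpI : Prime (p : ℤ) := Nat.prime_iff_prime_int.mp hp
  have hp0 : (p : ℤ) ^ δ ≠ 0 := pow_ne_zero _ (Nat.cast_ne_zero.mpr hp.ne_zero)
  -- `d = p^δ d₁`, `Q(w) = p^δ q₁` with `p ∤ d₁ q₁`
  obtain ⟨d₁, rfl⟩ := hpd
  obtain ⟨q₁, hq₁⟩ := hq
  have hd₁ : ¬ (p : ℤ) ∣ d₁ := fun h => hpd' (by rw [pow_succ]; exact mul_dvd_mul_left _ h)
  have hq₁' : ¬ (p : ℤ) ∣ q₁ := fun h => hq' (by rw [hq₁, pow_succ]; exact mul_dvd_mul_left _ h)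
  -- `x = p^δ x₁`
  set x₁ : Fin n → ℤ := (d₁ * φ w) • w - q₁ • v with hx₁
  have hxx₁ : x = ((p : ℤ) ^ δ) • x₁ := by
    rw [hx, hx₁, ← hφ w, hq₁, smul_sub, smul_smul, smul_smul, mul_assoc]
  -- `φ(x₁) = d₁ φ(w)²` is prime to `p`, so `x₁ ∉ p ℤⁿ`
  have hx₁p : ¬ ∀ i, (p : ℤ) ∣ x₁ i := by
    intro h
    obtain ⟨y, hy⟩ := exists_eq_smul_of_forall_dvd h
    have h1 : φ x₁ = d₁ * φ w * φ w := by
      rw [hx₁, map_sub, map_smul, map_smul, hφv, smul_eq_mul, smul_zero, sub_zero]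
    have h2 : (p : ℤ) ∣ d₁ * φ w * φ w := by
      rw [← h1, hy, map_smul, smul_eq_mul]
      exact Dvd.intro _ rfl
    rcases hpI.dvd_or_dvd h2 with h3 | h3
    · rcases hpI.dvd_or_dvd h3 with h4 | h4
      · exact hd₁ h4
      · exact hφw h4
    · exact hφw h3
  -- `G(x₁, u)` is prime to `p`
  have hx₁u : ¬ (p : ℤ) ∣ Matrix.toBilin' G x₁ u := by
    have h1 : Matrix.toBilin' G x₁ u = d₁ * φ w * Matrix.toBilin' G w u - q₁ * ((p : ℤ) ^ δ * d₁ * φ u) := by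
      rw [hx₁, map_sub, LinearMap.sub_apply, LinearMap.map_smul, LinearMap.smul_apply,
        LinearMap.map_smul, LinearMap.smul_apply, smul_eq_mul, smul_eq_mul, hφ u]
    rw [h1]
    intro h
    have h2 : (p : ℤ) ∣ q₁ * ((p : ℤ) ^ δ * d₁ * φ u) := by
      refine Dvd.dvd.mul_left (Dvd.dvd.mul_right (Dvd.dvd.mul_right ?_ _) _) _
      exact dvd_pow_self _ (by omega)
    have h3 := (dvd_sub_left h2).mp h
    rcases hpI.dvd_or_dvd h3 with h4 | h4
    · rcases hpI.dvd_or_dvd h4 with h5 | h5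
      · exact hd₁ h5
      · exact hφw h5
    · exact hu h4
  -- the content `c = p^δ c₁` with `p ∤ c₁`
  have hpc : (p : ℤ) ^ δ ∣ c := by
    rw [← hc]
    exact Finset.dvd_gcd fun i _ => by rw [hxx₁, Pi.smul_apply, smul_eq_mul]; exact Dvd.intro _ rfl
  obtain ⟨c₁, rfl⟩ := hpc
  have hc₁ : ¬ (p : ℤ) ∣ c₁ := by
    intro h
    apply hx₁p
    intro i
    have h1 : (p : ℤ) ^ δ * c₁ ∣ x i := by rw [← hc]; exact Finset.gcd_dvd (Finset.mem_univ i)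
    rw [hxx₁, Pi.smul_apply, smul_eq_mul] at h1
    exact (mul_dvd_mul_iff_left hp0).mp (dvd_trans (mul_dvd_mul_left _ h) h1)
  -- `c₁ z = x₁`
  have hz : x₁ = c₁ • z := by
    have h1 : ((p : ℤ) ^ δ) • x₁ = ((p : ℤ) ^ δ) • (c₁ • z) := by rw [← hxx₁, hcz, smul_smul]
    exact smul_right_injective _ hp0 h1
  rw [hz, LinearMap.map_smul, LinearMap.smul_apply, smul_eq_mul] at hx₁u
  exact fun h => hx₁u (Dvd.dvd.mul_left h _)

/-- **Maintenance primes** (`p ∤ d`): `G(x, v) = (v.w)²` is prime to `p`. [folklore] -/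
private theorem not_dvd_of_maintenance {p : ℕ} (hp : p.Prime) {T G : Matrix (Fin n) (Fin n) ℤ} (hG : G.IsSymm)
    {v w x z : Fin n → ℤ} {c : ℤ} (hvv : Matrix.toBilin' G v v = 0)
    (hvw : ¬ (p : ℤ) ∣ Matrix.toBilin' G v w)
    (hx : x = Matrix.toBilin' G v w • w - Matrix.toBilin' T w w • v) (hcz : x = c • z) :
    ¬ (p : ℤ) ∣ Matrix.toBilin' G z v := by
  have hpI : Prime (p : ℤ) := Nat.prime_iff_prime_int.mp hp
  have h1 : Matrix.toBilin' G x v = Matrix.toBilin' G v w * Matrix.toBilin' G v w := by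
    rw [hx, map_sub, LinearMap.sub_apply, LinearMap.map_smul, LinearMap.smul_apply, LinearMap.map_smul,
      LinearMap.smul_apply, smul_eq_mul, smul_eq_mul, hvv, mul_zero, sub_zero, toBilin'_comm hG w v]
  intro h
  have h2 : (p : ℤ) ∣ Matrix.toBilin' G x v := by
    rw [hcz, LinearMap.map_smul, LinearMap.smul_apply, smul_eq_mul]
    exact Dvd.dvd.mul_left h _
  rw [h1] at h2
  rcases hpI.dvd_or_dvd h2 with h3 | h3 <;> exact hvw h3

/-- `x = (v.w) w − Q(w) v` is isotropic when `v` is. [folklore] -/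
private theorem half_combination_eq_zero {T G : Matrix (Fin n) (Fin n) ℤ} (hG : G.IsSymm) (hT : T + Tᵀ = G)
    {v : Fin n → ℤ} (hv : Matrix.toBilin' T v v = 0) (w : Fin n → ℤ) :
    Matrix.toBilin' T (Matrix.toBilin' G v w • w - Matrix.toBilin' T w w • v)
      (Matrix.toBilin' G v w • w - Matrix.toBilin' T w w • v) = 0 := by
  rw [sub_eq_add_neg, ← neg_smul, half_add hT, half_smul, half_smul, hv, mul_zero, add_zero,
    LinearMap.map_smul₂, map_smul, smul_eq_mul, smul_eq_mul, toBilin'_comm hG w v]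
  ring


/-! ### §6 The theorem in coordinates -/

/-- **Nikulin, Cor. 1.13.5, in coordinates (hyperbolic-pair form).** Let `G ∈ Mₙ(ℤ)` be symmetric with even
diagonal and `det G ≠ 0`, and suppose `ℓ(A) + 3 ≤ n` for the discriminant group `A` of the lattice
`(ℤⁿ, G)`. If `(ℤⁿ, G)` has a non-zero isotropic vector, it contains a hyperbolic pair: `x.x = y.y = 0`,
`x.y = 1` ("there exists a lattice `T` such that `L ≃ U ⊕ T`"). Proof in the module docstring (a direct
local–global construction of an isotropic vector of divisor one; not Nikulin's genus-theoretic route).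
[cite: Nikulin1980, Cor. 1.13.5] [cite: Mase2017, Cor. 2.1 (p. 4)] [cite: Huybrechts2016K3, Ch. 14 Cor. 1.14 (proof: "`y' := y − ((y)²/2)x` still satisfies `(x.y') = 1`, but also `(y')² = 0`")] -/
theorem exists_hyperbolic_pair_pi {G : Matrix (Fin n) (Fin n) ℤ} (hG : G.IsSymm) (heven : ∀ i, 2 ∣ G i i)
    (hdet : G.det ≠ 0) (hlen : (Matrix.toBilin' G).length + 3 ≤ n)
    {v₀ : Fin n → ℤ} (hv₀0 : v₀ ≠ 0) (hv₀ : Matrix.toBilin' G v₀ v₀ = 0) :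
    ∃ x y : Fin n → ℤ, Matrix.toBilin' G x x = 0 ∧ Matrix.toBilin' G x y = 1 ∧
      Matrix.toBilin' G y y = 0 := by
  classical
  obtain ⟨T, hT⟩ := exists_add_transpose_eq hG heven
  have hBs : (Matrix.toBilin' G).IsSymm := Matrix.isSymm_toBilin'_iff_isSymm.mpr hG
  have hBe : (Matrix.toBilin' G).IsEven := fun x =>
    ⟨Matrix.toBilin' T x x, by rw [← two_mul, two_mul_half hT]⟩
  -- from a vector of divisor one to a hyperbolic pair
  have final : ∀ z u : Fin n → ℤ, Matrix.toBilin' G z z = 0 →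
      (Matrix.toBilin' G z u = 1 ∨ Matrix.toBilin' G z u = -1) →
      ∃ x y : Fin n → ℤ, Matrix.toBilin' G x x = 0 ∧ Matrix.toBilin' G x y = 1 ∧
        Matrix.toBilin' G y y = 0 := by
    intro z u hz hzu
    have hzu' : ∃ u', Matrix.toBilin' G z u' = 1 := by
      rcases hzu with h | h
      · exact ⟨u, h⟩
      · exact ⟨-u, by rw [map_neg, h, neg_neg]⟩
    obtain ⟨u', hu'⟩ := hzu'
    obtain ⟨y, hy, hzy⟩ := LinearMap.BilinForm.exists_hyperbolic_pair_of_isEven hBs hBe hz hu'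
    exact ⟨z, y, hz, hzy, hy⟩
  -- a vector pairing to a unit mod every prime has divisor one
  have crit : ∀ z : Fin n → ℤ, Matrix.toBilin' G z z = 0 →
      (∀ p : ℕ, p.Prime → ∃ t, ¬ (p : ℤ) ∣ Matrix.toBilin' G z t) →
      ∃ x y : Fin n → ℤ, Matrix.toBilin' G x x = 0 ∧ Matrix.toBilin' G x y = 1 ∧
        Matrix.toBilin' G y y = 0 := by
    intro z hz hwit
    obtain ⟨μ, u, hμ, hzu⟩ := Literature.Topology.FourManifolds.exists_divisor_generator (Matrix.toBilin' G) z
    have hμ1 : μ.natAbs = 1 := by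
      rw [Nat.eq_one_iff_not_exists_prime_dvd]
      intro p hp hpμ
      obtain ⟨t, ht⟩ := hwit p hp
      exact ht (dvd_trans (Int.natCast_dvd.mpr hpμ) (hμ t))
    refine final z u hz ?_
    rw [hzu]
    exact Int.natAbs_eq_natAbs_iff.mp (by rw [hμ1, Int.natAbs_one])
  -- a primitive isotropic vector `v`
  have hn : (Finset.univ : Finset (Fin n)).Nonempty := Finset.univ_nonempty_iff.mpr ⟨⟨0, by omega⟩⟩
  obtain ⟨v, hv₀v, hvg⟩ := Finset.extract_gcd v₀ hn
  have hv₀eq : v₀ = (Finset.univ.gcd v₀) • v :=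
    funext fun i => by rw [Pi.smul_apply, smul_eq_mul]; exact hv₀v i (Finset.mem_univ i)
  have hc₀0 : Finset.univ.gcd v₀ ≠ 0 := fun h => hv₀0 (by rw [hv₀eq, h, zero_smul])
  have hQv : Matrix.toBilin' T v v = 0 := by
    have h1 : 2 * (Finset.univ.gcd v₀ * Finset.univ.gcd v₀ * Matrix.toBilin' T v v) = 0 := by
      rw [← half_smul, two_mul_half hT, ← hv₀eq, hv₀]
    rcases mul_eq_zero.mp h1 with h | h
    · exact absurd h two_ne_zero
    · exact (mul_eq_zero.mp h).resolve_left (mul_ne_zero hc₀0 hc₀0)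
  have hvv : Matrix.toBilin' G v v = 0 := by rw [← two_mul_half hT, hQv, mul_zero]
  have hv0 : v ≠ 0 := fun h => hv₀0 (by rw [hv₀eq, h, smul_zero])
  -- the divisor `d` of `v`
  obtain ⟨d, u₀, hd, hdu₀⟩ := Literature.Topology.FourManifolds.exists_divisor_generator (Matrix.toBilin' G) v
  have hd0 : d ≠ 0 := by
    intro h
    rw [h] at hd
    apply hv0
    refine Matrix.eq_zero_of_mulVec_eq_zero hdet (funext fun i => ?_)
    rw [← toBilin'_single_right hG, Pi.zero_apply]
    exact zero_dvd_iff.mp (hd _)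
  by_cases hd1 : d.natAbs = 1
  · refine final v u₀ hvv ?_
    rw [hdu₀]
    exact Int.natAbs_eq_natAbs_iff.mp (by rw [hd1, Int.natAbs_one])
  -- `φ = (v.·)/d`
  obtain ⟨φ, hφ'⟩ := Literature.Topology.FourManifolds.exists_dual_smul_eq_of_forall_dvd (Matrix.toBilin' G) hd
  have hφ : ∀ t, d * φ t = Matrix.toBilin' G v t := fun t => by
    have := LinearMap.congr_fun hφ' t
    rwa [LinearMap.smul_apply, smul_eq_mul] at this
  have hφv : φ v = 0 := by
    have h := hφ v
    rw [hvv, mul_eq_zero] at h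
    exact h.resolve_left hd0
  have hφu₀ : φ u₀ = 1 := by
    have h := hφ u₀
    rw [hdu₀] at h
    exact (mul_eq_left₀ hd0).mp h
  -- the primes: prime factors of `det G · d`, exponents `δ_p + 1`
  have hD0 : G.det.natAbs * d.natAbs ≠ 0 :=
    mul_ne_zero (Int.natAbs_ne_zero.mpr hdet) (Int.natAbs_ne_zero.mpr hd0)
  have hrank : ∀ p : ℕ, (hp : p.Prime) →
      finrank (ZMod p) (LinearMap.ker (G.map (Int.castRingHom (ZMod p))).mulVecLin) + 3 ≤ n := by
    intro p hp
    haveI := Fact.mk hp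
    exact le_trans (Nat.add_le_add_right (finrank_ker_map_le_length p hG) 3) hlen
  -- local data
  have hloc : ∀ p : ℕ, ∃ a : Fin n → ℤ, p ∈ (G.det.natAbs * d.natAbs).primeFactors →
      ((p ∣ d.natAbs) → ¬ (p : ℤ) ∣ φ a ∧ (∃ u, ¬ (p : ℤ) ∣ Matrix.toBilin' G a u) ∧
         (p : ℤ) ^ (d.natAbs.factorization p) ∣ Matrix.toBilin' T a a ∧
         ¬ (p : ℤ) ^ (d.natAbs.factorization p + 1) ∣ Matrix.toBilin' T a a) ∧
      (¬ (p ∣ d.natAbs) → ¬ (p : ℤ) ∣ Matrix.toBilin' G v a) := by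
    intro p
    by_cases hpS : p ∈ (G.det.natAbs * d.natAbs).primeFactors
    · have hp : p.Prime := Nat.prime_of_mem_primeFactors hpS
      haveI := Fact.mk hp
      by_cases hpd : p ∣ d.natAbs
      · have hδ1 : 1 ≤ d.natAbs.factorization p :=
          hp.factorization_pos_of_dvd (Int.natAbs_ne_zero.mpr hd0) hpd
        have hu₀' : ¬ (p : ℤ) ∣ φ u₀ := by
          rw [hφu₀, Int.natCast_dvd, Int.natAbs_one, Nat.dvd_one]
          exact hp.one_lt.ne'
        obtain ⟨w₁, hq₁, hφ₁, u, hu₁⟩ := exists_local_vector p hG hT (hrank p hp) φ hu₀'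
        obtain ⟨w₂, ⟨y, rfl⟩, hq₂, hq₂'⟩ := hensel_exact hT hu₁ hq₁ hδ1
        refine ⟨w₁ + (p : ℤ) • y, fun _ =>
          ⟨fun _ => ⟨?_, ⟨u, not_dvd_toBilin'_add_smul hu₁ y⟩, hq₂, hq₂'⟩, fun h => absurd hpd h⟩⟩
        rw [map_add, map_smul, smul_eq_mul]
        exact fun h => hφ₁ ((dvd_add_left (Dvd.intro _ rfl)).mp h)
      · refine ⟨u₀, fun _ => ⟨fun h => absurd h hpd, fun _ => ?_⟩⟩
        rw [hdu₀, Int.natCast_dvd]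
        exact hpd
    · exact ⟨0, fun h => absurd h hpS⟩
  choose a ha using hloc
  -- CRT
  obtain ⟨w, hw⟩ := exists_forall_coord_congr (G.det.natAbs * d.natAbs).primeFactors
    (fun p hp => Nat.prime_of_mem_primeFactors hp) (fun p => d.natAbs.factorization p + 1) a
  -- the isotropic vector `x` and its normalisation `z`
  set x : Fin n → ℤ := Matrix.toBilin' G v w • w - Matrix.toBilin' T w w • v with hx
  have hQx : Matrix.toBilin' T x x = 0 := half_combination_eq_zero hG hT hQv w
  obtain ⟨z, hxz, hzg⟩ := Finset.extract_gcd x hn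
  have hcz : x = (Finset.univ.gcd x) • z :=
    funext fun i => by rw [Pi.smul_apply, smul_eq_mul]; exact hxz i (Finset.mem_univ i)
  -- `x ≠ 0`
  obtain ⟨p₀, hp₀, hp₀d⟩ := Nat.exists_prime_and_dvd hd1
  have hp₀S : p₀ ∈ (G.det.natAbs * d.natAbs).primeFactors :=
    Nat.mem_primeFactors.mpr ⟨hp₀, dvd_mul_of_dvd_right hp₀d _, hD0⟩
  have hx0 : x ≠ 0 := by
    intro h0
    obtain ⟨y, hy⟩ := hw p₀ hp₀S
    have hφa := ((ha p₀ hp₀S).1 hp₀d).1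
    have h1 : φ x = d * φ w * φ w := by
      rw [hx, map_sub, map_smul, map_smul, hφv, smul_zero, sub_zero, smul_eq_mul, ← hφ w]
    rw [h0, map_zero, eq_comm, mul_eq_zero, mul_eq_zero, or_iff_right hd0, or_self] at h1
    apply hφa
    have h2 : φ (a p₀) = φ w - (p₀ : ℤ) ^ (d.natAbs.factorization p₀ + 1) * φ y := by
      rw [hy, map_add, map_smul, smul_eq_mul, add_sub_cancel_right]
    rw [h2, h1, zero_sub, dvd_neg]
    exact Dvd.dvd.mul_right (dvd_pow_self _ (by omega)) _
  have hc0 : Finset.univ.gcd x ≠ 0 := fun h =>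
    hx0 (funext fun i => Finset.gcd_eq_zero_iff.mp h i (Finset.mem_univ i))
  have hQz : Matrix.toBilin' T z z = 0 := by
    have h1 : Finset.univ.gcd x * Finset.univ.gcd x * Matrix.toBilin' T z z = 0 := by
      rw [← half_smul, ← hcz, hQx]
    exact (mul_eq_zero.mp h1).resolve_left (mul_ne_zero hc0 hc0)
  have hzz : Matrix.toBilin' G z z = 0 := by rw [← two_mul_half hT, hQz, mul_zero]
  -- witnesses at every prime
  refine crit z hzz fun p hp => ?_
  haveI := Fact.mk hp
  have hpI : Prime (p : ℤ) := Nat.prime_iff_prime_int.mp hp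
  by_cases hpS : p ∈ (G.det.natAbs * d.natAbs).primeFactors
  · obtain ⟨y, hy⟩ := hw p hpS
    obtain ⟨hprog, hmaint⟩ := ha p hpS
    have hpe : (p : ℤ) ∣ (p : ℤ) ^ (d.natAbs.factorization p + 1) := dvd_pow_self _ (by omega)
    by_cases hpd : p ∣ d.natAbs
    · obtain ⟨hφa, ⟨u, hua⟩, hqa, hqa'⟩ := hprog hpd
      have hδ1 : 1 ≤ d.natAbs.factorization p :=
        hp.factorization_pos_of_dvd (Int.natAbs_ne_zero.mpr hd0) hpd
      refine ⟨u, not_dvd_of_progress hp hδ1 φ hφ hφv ?_ ?_ ?_ ?_ ?_ ?_ hx hcz rfl⟩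
      · have h1 := Nat.ordProj_dvd d.natAbs p
        rw [← Int.natCast_dvd, Nat.cast_pow] at h1
        exact h1
      · have h1 := Nat.pow_succ_factorization_not_dvd (Int.natAbs_ne_zero.mpr hd0) hp
        rw [← Int.natCast_dvd, Nat.cast_pow] at h1
        exact h1
      · rw [hy, map_add, map_smul, smul_eq_mul]
        exact fun h => hφa ((dvd_add_left (Dvd.dvd.mul_right hpe _)).mp h)
      · rw [hy, map_add, LinearMap.add_apply, LinearMap.map_smul, LinearMap.smul_apply, smul_eq_mul]
        exact fun h => hua ((dvd_add_left (Dvd.dvd.mul_right hpe _)).mp h)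
      · rw [hy, half_add_smul hT]
        refine Dvd.dvd.add (Dvd.dvd.add hqa (Dvd.dvd.mul_right ?_ _)) (Dvd.dvd.mul_right (Dvd.dvd.mul_right ?_ _) _)
          <;> exact pow_dvd_pow _ (Nat.le_succ _)
      · rw [hy, half_add_smul hT]
        intro h
        apply hqa'
        have h2 : (p : ℤ) ^ (d.natAbs.factorization p + 1) ∣
            (p : ℤ) ^ (d.natAbs.factorization p + 1) * Matrix.toBilin' G (a p) y +
            (p : ℤ) ^ (d.natAbs.factorization p + 1) * (p : ℤ) ^ (d.natAbs.factorization p + 1) *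
              Matrix.toBilin' T y y :=
          Dvd.dvd.add (Dvd.intro _ rfl) (Dvd.dvd.mul_right (Dvd.intro _ rfl) _)
        rw [add_assoc] at h
        exact (dvd_add_left h2).mp h
    · have hvw : ¬ (p : ℤ) ∣ Matrix.toBilin' G v w := by
        rw [hy, map_add, LinearMap.map_smul, smul_eq_mul]
        exact fun h => hmaint hpd ((dvd_add_left (Dvd.dvd.mul_right hpe _)).mp h)
      exact ⟨v, not_dvd_of_maintenance hp hG hvv hvw hx hcz⟩
  · have hdetp : ¬ (p : ℤ) ∣ G.det := by
      intro h
      apply hpS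
      rw [Nat.mem_primeFactors]
      exact ⟨hp, dvd_mul_of_dvd_left (Int.natCast_dvd.mp h) _, hD0⟩
    exact exists_not_dvd_of_not_dvd_det hG hdetp (not_forall_dvd_of_gcd_eq_one hzg hp)


end HyperbolicPlaneSplitting

/-! ### §7 The theorem for lattices, and the printed splitting `L ≅ U ⊕ T` -/

section General

variable {P : Type*} [AddCommGroup P] [Module.Finite ℤ P] [Module.Free ℤ P]

/-- **Nikulin, Cor. 1.13.5 (hyperbolic-pair form), for lattices with an isotropic vector.** Let `B` be a
symmetric, even, nondegenerate bilinear form on a finitely generated free `ℤ`-module `P` with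
`ℓ(A_B) + 3 ≤ rk P` (`ℓ` = `LinearMap.BilinForm.length`, the minimal number of generators of the discriminant
group). If `B` has a non-zero isotropic vector, then `P` contains a hyperbolic pair `x, y` (`x.x = y.y = 0`,
`x.y = 1`), i.e. `U ↪ P` and hence `P ≅ U ⊕ ⟨x,y⟩^⊥`. (Printed: "`t₊ ≥ 1`, `t₋ ≥ 1`, and `t₊ + t₋ ≥ 3 +
length A_L` … `L ≃ U ⊕ T`"; TODO(general form): the isotropic vector is automatic by Meyer in rank `≥ 5`,
`exists_hyperbolic_pair_of_isIndefinite_of_length_add_three_le`; the rank-`4` indefinite case is not covered.)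
[cite: Nikulin1980, Cor. 1.13.5] [cite: Mase2017, Cor. 2.1 (p. 4)] -/
theorem exists_hyperbolic_pair_of_length_add_three_le (B : LinearMap.BilinForm ℤ P) (hs : B.IsSymm)
    (he : B.IsEven) (hn : B.Nondegenerate) (hl : B.length + 3 ≤ finrank ℤ P)
    {v : P} (hv0 : v ≠ 0) (hv : B v v = 0) :
    ∃ x y : P, B x x = 0 ∧ B x y = 1 ∧ B y y = 0 := by
  classical
  set m := finrank ℤ P
  let b : Basis (Fin m) ℤ P := Module.finBasis ℤ P
  let e : P ≃ₗ[ℤ] (Fin m → ℤ) := b.equivFun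
  let B' : LinearMap.BilinForm ℤ (Fin m → ℤ) := LinearMap.BilinForm.congr e B
  have hB' : ∀ x y, B' x y = B (e.symm x) (e.symm y) := fun x y => LinearMap.BilinForm.congr_apply e B x y
  have hmap : ∀ x y, B' (e x) (e y) = B x y := fun x y => by
    rw [hB', e.symm_apply_apply, e.symm_apply_apply]
  let E : B.IsometryEquiv B' := { e with map_app' := fun x y => hmap x y }
  set G : Matrix (Fin m) (Fin m) ℤ := LinearMap.BilinForm.toMatrix' B' with hGdef
  have hGB : Matrix.toBilin' G = B' := Matrix.toBilin'_toMatrix' B'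
  have hG : G.IsSymm := by
    refine Matrix.isSymm_toBilin'_iff_isSymm.mp ⟨fun x y => ?_⟩
    rw [hGB, hB', hB']
    exact hs.eq _ _
  have heven : ∀ i, 2 ∣ G i i := fun i => by
    rw [hGdef, LinearMap.BilinForm.toMatrix'_apply, hB']
    exact even_iff_two_dvd.mp (he _)
  have hdet : G.det ≠ 0 := by
    rw [← LinearMap.BilinForm.nondegenerate_toBilin'_iff_det_ne_zero, hGB]
    exact hn.congr e
  have hlen : (Matrix.toBilin' G).length + 3 ≤ m := by
    rw [hGB, ← LinearMap.BilinForm.length_eq_of_addEquiv E.discriminantGroupCongr.toAddEquiv]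
    exact hl
  have hv' : Matrix.toBilin' G (e v) (e v) = 0 := by rw [hGB, hB', e.symm_apply_apply, hv]
  have hv0' : e v ≠ 0 := fun h => hv0 (by simpa using congrArg e.symm h)
  obtain ⟨x, y, hx, hxy, hy⟩ := HyperbolicPlaneSplitting.exists_hyperbolic_pair_pi hG heven hdet hlen hv0' hv'
  refine ⟨e.symm x, e.symm y, ?_, ?_, ?_⟩
  · rw [← hB', ← hGB, hx]
  · rw [← hB', ← hGB, hxy]
  · rw [← hB', ← hGB, hy]

/-- **Meyer's theorem for nondegenerate lattices**: a symmetric nondegenerate indefinite integral lattice of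
rank `≥ 5` has a non-zero isotropic vector — the rational form of a Gram matrix is nondegenerate of rank `≥ 5`
and indefinite, so represents zero (the tree's proved `meyer_holds`), and denominators clear. (The tree's
`exists_isotropic_of_five_le_finrank` is the unimodular case; same argument.)
[cite: Serre1973, Ch. IV §3.2 Cor. 2] -/
theorem exists_isotropic_of_five_le_finrank_of_nondegenerate {B : LinearMap.BilinForm ℤ P} (hB : B.IsSymm)
    (hn : B.Nondegenerate) (hind : B.IsIndefinite) (h5 : 5 ≤ finrank ℤ P) :
    ∃ x : P, x ≠ 0 ∧ B x x = 0 := by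
  classical
  set m := finrank ℤ P with hm
  let b : Basis (Fin m) ℤ P := Module.finBasis ℤ P
  set G : Matrix (Fin m) (Fin m) ℤ := LinearMap.BilinForm.toMatrix b B with hG
  set A : Matrix (Fin m) (Fin m) ℚ := G.map (Int.castRingHom ℚ) with hA
  have hGs : G.IsSymm := Matrix.IsSymm.ext fun i j => by
    simp only [hG, LinearMap.BilinForm.toMatrix_apply]
    exact hB.eq _ _
  have hAs : A.IsSymm := hGs.map _
  have hdet : A.det ≠ 0 := by
    have h1 : G.det ≠ 0 := (LinearMap.BilinForm.nondegenerate_iff_det_ne_zero b).mp hn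
    have h2 : A.det = (G.det : ℚ) := by rw [hA, ← RingHom.mapMatrix_apply, ← RingHom.map_det]; rfl
    rw [h2, Int.cast_ne_zero]
    exact h1
  obtain ⟨⟨x, hx⟩, ⟨y, hy⟩⟩ :=
    (LinearMap.BilinForm.isIndefinite_iff_exists_neg_pos_of_nondegenerate hB hn).mp hind
  have hpos : ∃ v : Fin m → ℚ, 0 < Matrix.toBilin' A v v :=
    ⟨fun i => (b.repr y i : ℚ), by
      rw [LinearMap.BilinForm.toBilin'_map_toMatrix_repr]; exact_mod_cast hy⟩
  have hneg : ∃ w : Fin m → ℚ, Matrix.toBilin' A w w < 0 :=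
    ⟨fun i => (b.repr x i : ℚ), by
      rw [LinearMap.BilinForm.toBilin'_map_toMatrix_repr]; exact_mod_cast hx⟩
  obtain ⟨v, hv0, hv⟩ := Literature.NumberTheory.QuadraticForms.meyer_holds A h5 hAs hdet hpos hneg
  obtain ⟨D, w, hD, hw⟩ := LinearMap.BilinForm.exists_int_eq_smul v
  let z : P := b.equivFun.symm w
  have hzw : ∀ i, b.repr z i = w i := fun i => by
    rw [← b.equivFun_apply, LinearEquiv.apply_symm_apply]
  have hw0 : w ≠ 0 := by
    intro h0
    apply hv0
    have : (D : ℚ) • v = 0 := by rw [← hw, h0]; ext i; simp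
    exact (smul_eq_zero.mp this).resolve_left (Nat.cast_ne_zero.mpr hD.ne')
  refine ⟨z, fun hz0 => hw0 ?_, ?_⟩
  · ext i
    rw [← hzw i, hz0, map_zero, Finsupp.zero_apply, Pi.zero_apply]
  · have h := LinearMap.BilinForm.toBilin'_map_toMatrix_smul_repr b B (D : ℚ) z
    have hcoord : ((D : ℚ) • fun i => (b.repr z i : ℚ)) = (D : ℚ) • ((D : ℚ) • v) := by
      rw [← hw]
      ext i
      simp [hzw]
    rw [hcoord, LinearMap.BilinForm.smul_left, LinearMap.BilinForm.smul_right,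
      LinearMap.BilinForm.smul_left, LinearMap.BilinForm.smul_right, hv, mul_zero, mul_zero,
      mul_zero, mul_zero] at h
    have hD0 : (D : ℚ) * D ≠ 0 := by positivity
    exact_mod_cast (mul_eq_zero.mp h.symm).resolve_left hD0

/-- **Nikulin, Cor. 1.13.5 (hyperbolic-pair form)**: a symmetric, even, nondegenerate, indefinite lattice
`P` of rank `≥ 5` with `ℓ(A_P) + 3 ≤ rk P` contains a hyperbolic pair ("If an even lattice `L` of signature
`(t₊, t₋)` satisfies `t₊ ≥ 1`, `t₋ ≥ 1`, and `t₊ + t₋ ≥ 3 + length A_L`, then, there exists a lattice `T`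
such that `L ≃ U ⊕ T`"; TODO(general form): rank `4`).
[cite: Nikulin1980, Cor. 1.13.5] [cite: Mase2017, Cor. 2.1 (p. 4)] -/
theorem exists_hyperbolic_pair_of_isIndefinite_of_length_add_three_le (B : LinearMap.BilinForm ℤ P) (hs : B.IsSymm)
    (he : B.IsEven) (hn : B.Nondegenerate) (hind : B.IsIndefinite) (h5 : 5 ≤ finrank ℤ P)
    (hl : B.length + 3 ≤ finrank ℤ P) :
    ∃ x y : P, B x x = 0 ∧ B x y = 1 ∧ B y y = 0 := by
  obtain ⟨v, hv0, hv⟩ := exists_isotropic_of_five_le_finrank_of_nondegenerate hs hn hind h5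
  exact exists_hyperbolic_pair_of_length_add_three_le B hs he hn hl hv0 hv

open Literature.Topology.FourManifolds in
/-- **Nikulin, Cor. 1.13.5 as printed — `L ≅ U ⊕ T`**: a symmetric, even, nondegenerate, indefinite
lattice `P` of rank `≥ 5` with `ℓ(A_P) + 3 ≤ rk P` is isometric to `U ⊕ T`, `U` the hyperbolic plane
(`hyperbolicForm`) and `T = ⟨x, y⟩^⊥` for a hyperbolic pair `x, y` (Serre's splitting, the tree's
`IsometryEquiv.splitHyperbolic`). TODO(general form): rank `4`.
[cite: Nikulin1980, Cor. 1.13.5] [cite: Mase2017, Cor. 2.1 (p. 4)] [cite: Serre1973, Ch. V §3.5 Lemma 5] -/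
theorem equivalent_hyperbolicForm_prod_of_length_add_three_le (B : LinearMap.BilinForm ℤ P) (hs : B.IsSymm)
    (he : B.IsEven) (hn : B.Nondegenerate) (hind : B.IsIndefinite) (h5 : 5 ≤ finrank ℤ P)
    (hl : B.length + 3 ≤ finrank ℤ P) :
    ∃ x y : P, B x x = 0 ∧ B x y = 1 ∧ B y y = 0 ∧
      B.Equivalent (hyperbolicForm.prod (B.restrict (B.orthogonal (Submodule.span ℤ {x, y})))) := by
  obtain ⟨x, y, hx, hxy, hy⟩ := exists_hyperbolic_pair_of_isIndefinite_of_length_add_three_le B hs he hn hind h5 hl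
  exact ⟨x, y, hx, hxy, hy, ⟨LinearMap.BilinForm.IsometryEquiv.splitHyperbolic hs x y hx hy hxy⟩⟩

end General

end Literature.Topology.FourManifolds
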